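import Literature.Analysis.FluidPDE.KatoRemainderL3
import Literature.Analysis.FluidPDE.KatoLocalLerayPressure
import Literature.Analysis.FluidPDE.KatoMaximalTimeSingular
import Literature.Analysis.FluidPDE.ClassicalSolutionCalculus
import HarnessLib

/-!
# Route HardyPointSink — `HardyEnergyBound`: the classical representative of a Kato solution
lies in `L³((a, T) × ℝ³)` up to the final time

Helper file for item stmt-NavierStokesRegularity-7979 (`HardyEnergyBound`, line `birth`, stub
`stub_spaceTimeL3`). For `ν > 0`, a Kato solution `u` on `[0, T)`
(`Literature.Analysis.FluidPDE.IsKatoSolutionOn`) and a classical representative `(v, p)` of `u`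
on the open strip `(0, T)` (`v t = u t` a.e. for every `t ∈ (0, T)`), the velocity `v` satisfies
`∫_a^T ∫ |v|³ dx dt < ∞` for every `0 < a < T` — a bound valid UP TO the final time `T`
(Lemarié-Rieusset 2016, Thm. 15.1; Rusin–Šverák 2011, §4).

Route of the proof (all ingredients are in the tree):

* Kato's smoothing bound makes `u` essentially bounded on `(a/2, a) × ℝ³`
  (`IsKatoSolutionOn.exists_ae_norm_le_of_pos`); by Tonelli (`Measure.ae_ae_of_ae_prod`) some
  slice `u s`, `a/2 < s < a`, is essentially bounded (`hardyEnergyBound_spaceTimeL3_exists_slice`);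
* the restarted solution `t ↦ u (s + t)` is a Kato solution on `[0, T - s)` with the bounded datum
  `u s` (`IsKatoSolutionOn.restart`), hence `∫₀^{T-s} ∫ |u(s + t, x)|³ < ∞`
  (`IsKatoSolutionOn.lintegral_enorm_cube_lt_top_of_ae_bounded`, the energy class of the caloric
  remainder up to the final time);
* the time translation `(t, x) ↦ (s + t, x)` preserves Lebesgue measure on `ℝ × ℝ³`
  (`hardyEnergyBound_spaceTimeL3_lintegral_shift`), so `∫_s^T ∫ |u|³ < ∞`, and `(a, T) ⊆ (s, T)`;
* `v = u` a.e. on the strip `(0, T) × ℝ³` (`ae_restrict_prod_of_forall_ae_eq`: `v` is jointly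
  continuous, `u` is measurable on the strip, and the slices agree a.e.), so the two space–time
  integrals over `(a, T) × ℝ³` coincide.
-/

noncomputable section

open MeasureTheory Set Filter Topology Function
open scoped ENNReal NNReal

set_option linter.dupNamespace false -- nested layout Summit.<S>.<Sub>, Sub = S (D-0017)

namespace Summit.NavierStokesRegularity.NavierStokesRegularity.Theorems

open Literature.Analysis.FluidPDE

/-! ### Tools: a bounded slice, and the time translation of a space–time integral -/

/-- **A bounded slice from space–time boundedness.** If `‖u(t, x)‖ ≤ M` for a.e. `(t, x)` in
`(a', S) × ℝ³` with `a' < S`, then some slice `u s`, `s ∈ (a', S)`, satisfies `‖u s x‖ ≤ M` for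
a.e. `x` (Tonelli: almost every slice does, and `(a', S)` has positive measure). -/
theorem hardyEnergyBound_spaceTimeL3_exists_slice
    {u : ℝ → EuclideanSpace ℝ (Fin 3) → EuclideanSpace ℝ (Fin 3)} {a' S M : ℝ} (hlt : a' < S)
    (h : ∀ᵐ z ∂(volume.restrict (Ioo a' S ×ˢ (univ : Set (EuclideanSpace ℝ (Fin 3))))),
      ‖u z.1 z.2‖ ≤ M) :
    ∃ s ∈ Ioo a' S, ∀ᵐ x ∂(volume : Measure (EuclideanSpace ℝ (Fin 3))), ‖u s x‖ ≤ M := by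
  have hprod : (volume.restrict (Ioo a' S ×ˢ (univ : Set (EuclideanSpace ℝ (Fin 3))))) =
      ((volume : Measure ℝ).restrict (Ioo a' S)).prod
        (volume : Measure (EuclideanSpace ℝ (Fin 3))) := by
    rw [show (volume : Measure (ℝ × EuclideanSpace ℝ (Fin 3))) = (volume : Measure ℝ).prod volume
        from rfl, ← Measure.prod_restrict, Measure.restrict_univ]
  rw [hprod] at h
  have h2 : ∀ᵐ t ∂((volume : Measure ℝ).restrict (Ioo a' S)),
      ∀ᵐ x ∂(volume : Measure (EuclideanSpace ℝ (Fin 3))), ‖u t x‖ ≤ M :=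
    Measure.ae_ae_of_ae_prod h
  have h3 : ∀ᵐ t ∂((volume : Measure ℝ).restrict (Ioo a' S)),
      t ∈ Ioo a' S ∧ ∀ᵐ x ∂(volume : Measure (EuclideanSpace ℝ (Fin 3))), ‖u t x‖ ≤ M := by
    filter_upwards [ae_restrict_mem measurableSet_Ioo, h2] with t ht htM using ⟨ht, htM⟩
  haveI : (ae ((volume : Measure ℝ).restrict (Ioo a' S))).NeBot := by
    refine ae_neBot.2 fun h0 => ?_
    rw [Measure.restrict_eq_zero, Real.volume_Ioo, ENNReal.ofReal_eq_zero] at h0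
    linarith
  obtain ⟨s, hs, hsM⟩ := h3.exists
  exact ⟨s, hs, hsM⟩

/-- **Time translation of a space–time integral.** For `f ≥ 0` on `ℝ × ℝ³` and `s, T : ℝ`,
`∫_{(0, T-s) × ℝ³} f(s + t, x) = ∫_{(s, T) × ℝ³} f(t, x)`: the shear `(t, x) ↦ (s + t, x)` is a
measurable embedding preserving Lebesgue measure on `ℝ × ℝ³` and pulls `(s, T) × ℝ³` back to
`(0, T - s) × ℝ³`. -/
theorem hardyEnergyBound_spaceTimeL3_lintegral_shift
    (f : ℝ → EuclideanSpace ℝ (Fin 3) → ℝ≥0∞) (s T : ℝ) :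
    ∫⁻ z in Ioo 0 (T - s) ×ˢ (univ : Set (EuclideanSpace ℝ (Fin 3))), f (s + z.1) z.2 =
      ∫⁻ z in Ioo s T ×ˢ (univ : Set (EuclideanSpace ℝ (Fin 3))), f z.1 z.2 := by
  have hmp : MeasurePreserving (fun z : ℝ × EuclideanSpace ℝ (Fin 3) => (s + z.1, z.2))
      (volume : Measure (ℝ × EuclideanSpace ℝ (Fin 3)))
      (volume : Measure (ℝ × EuclideanSpace ℝ (Fin 3))) :=
    (measurePreserving_add_left (volume : Measure ℝ) s).prod
      (MeasurePreserving.id (volume : Measure (EuclideanSpace ℝ (Fin 3))))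
  have hemb : MeasurableEmbedding (fun z : ℝ × EuclideanSpace ℝ (Fin 3) => (s + z.1, z.2)) :=
    (measurableEmbedding_addLeft s).prodMap MeasurableEmbedding.id
  have hpre : (fun z : ℝ × EuclideanSpace ℝ (Fin 3) => (s + z.1, z.2)) ⁻¹'
      (Ioo s T ×ˢ (univ : Set (EuclideanSpace ℝ (Fin 3)))) =
        Ioo 0 (T - s) ×ˢ (univ : Set (EuclideanSpace ℝ (Fin 3))) := by
    ext z
    simp only [mem_preimage, mem_prod, mem_Ioo, mem_univ, and_true]
    constructor
    · rintro ⟨h1, h2⟩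
      exact ⟨by linarith, by linarith⟩
    · rintro ⟨h1, h2⟩
      exact ⟨by linarith, by linarith⟩
  have h := hmp.setLIntegral_comp_preimage_emb hemb
    (fun z : ℝ × EuclideanSpace ℝ (Fin 3) => f z.1 z.2) (Ioo s T ×ˢ univ)
  rw [hpre] at h
  exact h

/-! ### The `L³` bound for the Kato solution itself -/

/-- **A Kato solution is in `L³((a, T) × ℝ³)` for every `0 < a < T`** (up to the final time).
For `ν > 0` and a Kato solution `u` on `[0, T)`: pick a slice `s ∈ (a/2, a)` where `u s` is
essentially bounded (Kato's smoothing bound `IsKatoSolutionOn.exists_ae_norm_le_of_pos` and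
`hardyEnergyBound_spaceTimeL3_exists_slice`), restart there (`IsKatoSolutionOn.restart`), apply
the bounded-datum space–time `L³` bound up to the final time
(`IsKatoSolutionOn.lintegral_enorm_cube_lt_top_of_ae_bounded`), translate back in time
(`hardyEnergyBound_spaceTimeL3_lintegral_shift`) and shrink `(s, T)` to `(a, T)`. -/
theorem hardyEnergyBound_spaceTimeL3_kato {T ν a : ℝ}
    {u₀ : EuclideanSpace ℝ (Fin 3) → EuclideanSpace ℝ (Fin 3)}
    {u : ℝ → EuclideanSpace ℝ (Fin 3) → EuclideanSpace ℝ (Fin 3)} (hν : 0 < ν)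
    (hu : IsKatoSolutionOn T ν u₀ u) (ha : 0 < a) (haT : a < T) :
    ∫⁻ z in Ioo a T ×ˢ (univ : Set (EuclideanSpace ℝ (Fin 3))), ‖u z.1 z.2‖ₑ ^ (3 : ℝ) < ∞ := by
  -- a bounded slice `u s`, `a/2 < s < a`
  obtain ⟨M, hM⟩ := hu.exists_ae_norm_le_of_pos hν (half_pos ha) haT
  obtain ⟨s, hs, hsM⟩ := hardyEnergyBound_spaceTimeL3_exists_slice (half_lt_self ha) hM
  have hs0 : 0 < s := (half_pos ha).trans hs.1
  have hsT : s < T := hs.2.trans haT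
  -- restart at `s` and apply the bounded-datum bound up to the final time `T - s`
  have hr : IsKatoSolutionOn (T - s) ν (u s) (fun t => u (s + t)) := hu.restart hν ⟨hs0.le, hsT⟩
  -- (no expected type here: unifying `‖?u z.1 z.2‖ₑ` against `‖u (s + z.1) z.2‖ₑ` before `hr`
  -- fixes `?u` sends the unifier into the normed-space internals)
  have hfin := hr.lintegral_enorm_cube_lt_top_of_ae_bounded hν (sub_pos.2 hsT) hsM
  -- translate back: finiteness on `(s, T) × ℝ³`
  have hshift := hardyEnergyBound_spaceTimeL3_lintegral_shift
    (fun t x => ‖u t x‖ₑ ^ (3 : ℝ)) s T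
  have hfin' : ∫⁻ z in Ioo s T ×ˢ (univ : Set (EuclideanSpace ℝ (Fin 3))),
      ‖u z.1 z.2‖ₑ ^ (3 : ℝ) < ∞ :=
    hshift.symm.trans_lt hfin
  -- shrink `(s, T)` to `(a, T)`
  exact lt_of_le_of_lt (lintegral_mono_set (prod_mono (Ioo_subset_Ioo_left hs.2.le) Subset.rfl))
    hfin'

/-! ### The stub -/

/-- **stub `stub_spaceTimeL3` of the crux `HardyPointSink.HardyEnergyBound` (line `birth`): the
classical representative of a Kato solution lies in `L³((a, T) × ℝ³)` up to the final time.**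
For `ν > 0`, `T > 0`, a Kato solution `u` on `[0, T)` with datum `u₀`, and a classical solution
`(v, p)` of the unforced Navier–Stokes system on the open strip `(0, T)` with `v t = u t` a.e. for
every `t ∈ (0, T)`: `∫_{(a, T) × ℝ³} |v|³ < ∞` for every `0 < a < T`. The bound for `u` is
`hardyEnergyBound_spaceTimeL3_kato`; `v = u` a.e. on `(0, T) × ℝ³` because `v` is jointly
continuous (hence measurable) on the strip, `u` is measurable there, and the slices agree a.e.
(`ae_restrict_prod_of_forall_ae_eq`), so the two integrals over `(a, T) × ℝ³` coincide.
(Lemarié-Rieusset 2016, Thm. 15.1; Rusin–Šverák 2011, §4.) -/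
theorem stub_spaceTimeL3 :
    ∀ ν : ℝ, 0 < ν → ∀ (T : ℝ) (u₀ : EuclideanSpace ℝ (Fin 3) → EuclideanSpace ℝ (Fin 3))
      (u : ℝ → EuclideanSpace ℝ (Fin 3) → EuclideanSpace ℝ (Fin 3)), 0 < T →
      Literature.Analysis.FluidPDE.IsKatoSolutionOn T ν u₀ u →
      ∀ (v : ℝ → EuclideanSpace ℝ (Fin 3) → EuclideanSpace ℝ (Fin 3))
        (p : ℝ → EuclideanSpace ℝ (Fin 3) → ℝ),
      Literature.Analysis.FluidPDE.IsClassicalNSSolutionOn (Set.Ioo 0 T) ν 0 v p →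
      (∀ t ∈ Set.Ioo 0 T, v t =ᵐ[MeasureTheory.volume] u t) →
      ∀ a : ℝ, 0 < a → a < T →
      ∫⁻ z in Set.Ioo a T ×ˢ (Set.univ : Set (EuclideanSpace ℝ (Fin 3))), ‖v z.1 z.2‖ₑ ^ (3 : ℝ) < ⊤ := by
  intro ν hν T u₀ u _hT hu v _p hv hvu a ha haT
  -- the bound for the Kato solution `u` itself
  have hfin : ∫⁻ z in Ioo a T ×ˢ (univ : Set (EuclideanSpace ℝ (Fin 3))),
      ‖u z.1 z.2‖ₑ ^ (3 : ℝ) < ∞ :=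
    hardyEnergyBound_spaceTimeL3_kato hν hu ha haT
  -- `v = u` a.e. on the strip `(0, T) × ℝ³`, hence on `(a, T) × ℝ³`
  have hvm : AEStronglyMeasurable (uncurry v)
      (volume.restrict (Ioo 0 T ×ˢ (univ : Set (EuclideanSpace ℝ (Fin 3))))) :=
    hv.smooth_velocity.continuousOn.aestronglyMeasurable
      (isOpen_Ioo.prod isOpen_univ).measurableSet
  have hae : uncurry v =ᵐ[volume.restrict (Ioo 0 T ×ˢ (univ : Set (EuclideanSpace ℝ (Fin 3))))]
      uncurry u :=
    ae_restrict_prod_of_forall_ae_eq hvu hvm hu.aestronglyMeasurable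
  have hsub : Ioo a T ×ˢ (univ : Set (EuclideanSpace ℝ (Fin 3))) ⊆ Ioo 0 T ×ˢ univ :=
    prod_mono (Ioo_subset_Ioo_left ha.le) Subset.rfl
  have hae' : ∀ᵐ z ∂(volume.restrict (Ioo a T ×ˢ (univ : Set (EuclideanSpace ℝ (Fin 3))))),
      uncurry v z = uncurry u z :=
    ae_restrict_of_ae_restrict_of_subset hsub hae
  have hcongr : ∫⁻ z in Ioo a T ×ˢ (univ : Set (EuclideanSpace ℝ (Fin 3))), ‖v z.1 z.2‖ₑ ^ (3 : ℝ) =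
      ∫⁻ z in Ioo a T ×ˢ (univ : Set (EuclideanSpace ℝ (Fin 3))), ‖u z.1 z.2‖ₑ ^ (3 : ℝ) := by
    refine lintegral_congr_ae ?_
    filter_upwards [hae'] with z hz
    rw [show v z.1 z.2 = u z.1 z.2 from hz]
  rw [hcongr]
  exact hfin

end Summit.NavierStokesRegularity.NavierStokesRegularity.Theorems

end
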